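/-
Copyright (c) 2026 the pub-hodgecm-mathlib formalisation cell (harness21).  Prover seat hodgecm-mathlib-LH5-p04 (g5): (C5)′ «TorusAll» — the ONE `obtain` letters block
(LH4-plan (g7) WORD #57; LH4-p03 (g8) CENSUS-CountJZeroTrace 7f90bff2 §0 (4); LH4-p01 (g6) CENSUS-Large 1cf80271 §0 (4)∕(8), L2 rf v2 amendments (a)(b)); 2026-09-02.
-/
import Literature.NumberTheory.Automorphic.UnitaryThreeTraceTorusCornerLetters   -- ★ p852069 (this seat): `κ, G, r` at the literal and their valuations
import Literature.NumberTheory.Automorphic.HermitianLatticesLocal               -- ★ `UnramifiedLocalConjDatum` (`σσ`, `vσ`, `v_pow`, `ϖ_ne_zero`)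
import HarnessLib

/-!
# The `j = 0` regime letters of the θ̄ = 0 trace torus literal, PACKAGED for the two dispatchers (`…CountJZeroTrace` H1′, `…CountJZeroLargeDispatchTrace` L2′)
# under the (V2) regime datum (Flicker 1998 Prop. 13; Rogawski 1990 Prop. 4.9.1)

Topic `NumberTheory/Automorphic`; namespace `Literature.NumberTheory.Automorphic.UnitaryGroup`.  THEOREMS ONLY (no `def`, no instance, no notation, no named fact, no `sorry`);
count-neutral; kernel lane `--supports stmt-HodgeConjecture-24833`.  Cell `pub/hodgecm-mathlib` (D-0151), crux H413 = `stmt-HodgeConjecture-24833`, LH4 board (D-UNR) list (5), (C5)′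
TorusAll (LH4-plan (g7) WORDS #46∕#50∕#57): the (C5)′ dispatchers of Prop. 13's `j = 0` column — H1′ (`m ≤ N`, LH4-p03) and L2′ (`m > N`, LH4-p01) — bind ONE dictionary of letters
`{κ b₀ G r s w₀ y₀}` with `(hκ : |κ| = 1) (htr : |κ + σκ| = 1) (hrv : N ≤ N₊ → |r| ≤ 1) (hb₀ : b₀ + σb₀ = 1) (hb₀v) (hB₁ : B₁ = κσκ·B₂) (hAD : A − D = (σκ − κ)B₂)
(hG : B₂G = (D − b − κB₂)s) (hr : r(κ+σκ) = b₀G + σb₀σG) (hc0 : z + r = κw₀ + y₀) (hσw₀) (hσy₀) (hB : |B₂| = |ϖ^N|) (hsδ : N₊ < N → |D − b| = |ϖ^{N₊}|)`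
and the primed regime datum `hreg′ : N₊ < N ∨ (N ≤ N₊ ∧ N ≤ M ∧ |r(s+r)| ≤ |ϖ^{M−N}| ∧ (1 ≤ N → =) ∧ |G − σG| = |ϖ^M|)`.  THIS FILE produces ALL of them at once at the θ̄ = 0 trace
literal `!![x₁σb + x₃b, 0, x₁ − x₃; 0, x₂, 0; bσb(x₁ − x₃), 0, x₁b + x₃σb]` (corner `A = x₁σb + x₃b`, `B₁ = x₁ − x₃`, `B₂ = bσb(x₁ − x₃)`, `D = x₁b + x₃σb`, mid `x₂`) from the
eigen-data `(hN hN₁ hN₂)` and the **(V2) regime datum** (WORD #50)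
`(h : (N₁ < N ∧ N₂ = N₁ ∧ N₊ = N₁ ∧ |E| = |ϖ^{N₁}|) ∨ (N ≤ N₁ ∧ N ≤ N₊ ∧ |E| ≤ |ϖ^N|))`, `E = (x₁ − x₂)σb + (x₃ − x₂)b`, with `M := max N₁ N₂`, `b₀ := b`, `κ := (σb)⁻¹`,
`G := (x₃ − x₂)s∕(bσb(x₁ − x₃))`, `r := (x₃ − x₂)s(bx₂ + σbx₁)∕((x₁ − x₃)x₂)`, `w₀ := (z + r + σ(z + r))∕(κ + σκ)`, `y₀ := z + r − κw₀` (the 2-free decomposition: `κ + σκ = (bσb)⁻¹` is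
a unit — no `½`).  Everything is ★ p852069 read at `π = π′ = 1` plus the (V2) bookkeeping (`N₂ ≥ N` and `N₁ + N₂ = N + M` in type B, ultrametric; `|D − b| = |ϖ^{N₊}|` in type A by strict domination).
So ★'s `…CountJZeroTorusAll`'s in-line `f∕g`-split block (:121–:158, `e = ½`) becomes ONE `obtain` in the trace twin.  HONEST READER LABEL: base-layer algebra; asserts NO cell value; pays no organ,
opens no road ((D-UNR) PRINT by D74′); HC_CM is proved only modulo the 7 printed citations (2 remaining named inputs: hLiu418 = stmt-HodgeConjecture-24832, h413 = stmt-HodgeConjecture-24833) until rung 0 closes.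

## References
* [Flicker1998UnitaryFL] Y. Z. Flicker, *Elementary proof of the fundamental lemma for a unitary group*, Canad. J. Math. 50 (1998), Prop. 13 pp. 91–93.
* [Rogawski1990] J. D. Rogawski, *Automorphic Representations of Unitary Groups in Three Variables* (1990), §4.9 Prop. 4.9.1 p. 55.
-/

set_option autoImplicit false

open Matrix
open scoped MatrixGroups WithZero

namespace Literature.NumberTheory.Automorphic.UnitaryGroup

variable {K : Type*} [Field K] [Valued K ℤᵐ⁰] (σ : K →+* K) {ϖ : K}

set_option maxHeartbeats 800000 in
/-- **THE LETTERS BLOCK AT THE θ̄ = 0 TRACE LITERAL (under the (V2) regime datum).**  See the module docstring for the dictionary; the witnesses are `κ = (σb)⁻¹`, `G`, `r` of ★ p852069,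
and `w₀, y₀` the 2-free `κ`-frame decomposition of `z + r` (`z` the level element's letter).  [cite: Flicker1998UnitaryFL, Prop. 13 pp. 91–93] [cite: Rogawski1990, §4.9 Prop. 4.9.1 p. 55] -/
theorem exists_traceTorus_jzero_letters (hd : HermitianLattice.UnramifiedLocalConjDatum σ ϖ)
    {b s x₁ x₂ x₃ z : K} {N N₁ N₂ Np : ℕ}
    (hb : b + σ b = 1) (hbv : Valued.v b = 1) (hσs : σ s = s) (hsv : Valued.v s = 1)
    (hx₁ : σ x₁ * x₁ = 1) (hx₂ : σ x₂ * x₂ = 1) (hx₃ : σ x₃ * x₃ = 1)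
    (hN : Valued.v (x₁ - x₃) = Valued.v (ϖ ^ N)) (hN₁ : Valued.v (x₁ - x₂) = Valued.v (ϖ ^ N₁)) (hN₂ : Valued.v (x₃ - x₂) = Valued.v (ϖ ^ N₂))
    (h : (N₁ < N ∧ N₂ = N₁ ∧ Np = N₁ ∧ Valued.v ((x₁ - x₂) * σ b + (x₃ - x₂) * b) = Valued.v (ϖ ^ N₁)) ∨
      (N ≤ N₁ ∧ N ≤ Np ∧ Valued.v ((x₁ - x₂) * σ b + (x₃ - x₂) * b) ≤ Valued.v (ϖ ^ N))) :
    ∃ κ G r w₀ y₀ : K,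
      Valued.v κ = 1 ∧ Valued.v (κ + σ κ) = 1 ∧ (N ≤ Np → Valued.v r ≤ 1) ∧
      (x₁ - x₃) = κ * σ κ * (b * σ b * (x₁ - x₃)) ∧
      (x₁ * σ b + x₃ * b) - (x₁ * b + x₃ * σ b) = (σ κ - κ) * (b * σ b * (x₁ - x₃)) ∧
      b * σ b * (x₁ - x₃) * G = ((x₁ * b + x₃ * σ b) - x₂ - κ * (b * σ b * (x₁ - x₃))) * s ∧
      r * (κ + σ κ) = b * G + σ b * σ G ∧
      z + r = κ * w₀ + y₀ ∧ σ w₀ = w₀ ∧ σ y₀ = -y₀ ∧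
      Valued.v (b * σ b * (x₁ - x₃)) = Valued.v (ϖ ^ N) ∧
      (Np < N → Valued.v ((x₁ * b + x₃ * σ b) - x₂) = Valued.v (ϖ ^ Np)) ∧
      (Np < N ∨ (N ≤ Np ∧ N ≤ max N₁ N₂ ∧ Valued.v (r * (s + r)) ≤ Valued.v (ϖ ^ (max N₁ N₂ - N)) ∧
        (1 ≤ N → Valued.v (r * (s + r)) = Valued.v (ϖ ^ (max N₁ N₂ - N))) ∧ Valued.v (G - σ G) = Valued.v (ϖ ^ (max N₁ N₂)))) := by
  have hσσ := hd.σσ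
  have hϖ0 : ϖ ≠ 0 := hd.ϖ_ne_zero
  have hσbv : Valued.v (σ b) = 1 := by rw [hd.vσ]; exact hbv
  have hb0 : b ≠ 0 := fun h0 => by rw [h0, map_zero] at hbv; exact zero_ne_one hbv
  have hσb0 : σ b ≠ 0 := fun h0 => by rw [h0, map_zero] at hσbv; exact zero_ne_one hσbv
  have hx₂v : Valued.v x₂ = 1 := Literature.NumberTheory.LocalFields.valued_eq_one_of_map_mul_self_eq_one hd.vσ hx₂
  have hx20 : x₂ ≠ 0 := fun h0 => by rw [h0, map_zero] at hx₂v; exact zero_ne_one hx₂v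
  have h13 : x₁ ≠ x₃ := by
    intro h0; rw [h0, sub_self, map_zero] at hN; exact pow_ne_zero N hϖ0 ((Valuation.zero_iff _).1 hN.symm)
  have hNv : Valued.v (ϖ ^ N) ≠ 0 := (Valuation.ne_zero_iff _).2 (pow_ne_zero N hϖ0)
  have vle : ∀ {i j : ℕ}, Valued.v (ϖ ^ i) ≤ Valued.v (ϖ ^ j) ↔ j ≤ i := fun {i j} => by rw [hd.v_pow, hd.v_pow, WithZero.exp_le_exp]; omega
  have vlt : ∀ {i j : ℕ}, Valued.v (ϖ ^ i) < Valued.v (ϖ ^ j) ↔ j < i := fun {i j} => by rw [hd.v_pow, hd.v_pow, WithZero.exp_lt_exp]; omega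
  have veq : ∀ {i j : ℕ}, Valued.v (ϖ ^ i) = Valued.v (ϖ ^ j) ↔ i = j := fun {i j} => by rw [hd.v_pow, hd.v_pow, WithZero.exp_inj]; omega
  -- the letters at `π = π′ = 1`
  have h11 : (1 : K) * 1 = 1 := one_mul 1
  have hσ1 : σ 1 = 1 := map_one σ
  have hκmul := traceKappa_mul_map σ hσσ (b := b) hσ1 hb0 hσb0
  have hκadd := traceKappa_add_map σ hσσ hb hσ1 hb0 hσb0
  have hB₁ := traceCorner_B₁_eq σ hσσ h11 hσ1 hb0 hσb0 x₁ x₃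
  have hAD := traceCorner_A_sub_D σ hσσ h11 hσ1 hb0 hσb0 x₁ x₃
  have hG := traceCorner_G_spec σ (x₂ := x₂) hb h11 hb0 hσb0 h13 s
  have hr := traceCorner_r_spec σ hσσ hb hσ1 hσs hb0 hσb0 hx₁ hx₂ hx₃ h13
  simp only [one_mul, one_div, one_pow] at hκmul hκadd hB₁ hAD hG hr
  -- valuations of `κ` and `κ + σκ`
  have hκv : Valued.v (σ b)⁻¹ = 1 := by rw [map_inv₀, hσbv, inv_one]
  have htrv : Valued.v ((σ b)⁻¹ + σ (σ b)⁻¹) = 1 := by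
    rw [hκadd, map_inv₀, map_mul, hbv, hσbv, one_mul, inv_one]
  have htr0 : (σ b)⁻¹ + σ (σ b)⁻¹ ≠ 0 := fun h0 => by rw [h0, map_zero] at htrv; exact zero_ne_one htrv
  -- the `κ`-frame decomposition of `z + r`
  obtain ⟨rr, hrr⟩ : ∃ rr : K, rr = (x₃ - x₂) * s * (b * x₂ + σ b * x₁) / ((x₁ - x₃) * x₂) := ⟨_, rfl⟩
  rw [← hrr] at hr
  obtain ⟨w₀, hw₀⟩ : ∃ w₀ : K, w₀ = (z + rr + σ (z + rr)) / ((σ b)⁻¹ + σ (σ b)⁻¹) := ⟨_, rfl⟩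
  have hσκκ : σ ((σ b)⁻¹ + σ (σ b)⁻¹) = (σ b)⁻¹ + σ (σ b)⁻¹ := by rw [map_add, map_inv₀, map_inv₀, hσσ, add_comm]
  have hσw₀ : σ w₀ = w₀ := by
    rw [hw₀, map_div₀, hσκκ, map_add, hσσ, add_comm (σ (z + rr))]
  have hc0 : z + rr = (σ b)⁻¹ * w₀ + (z + rr - (σ b)⁻¹ * w₀) := by ring
  have hσy₀ : σ (z + rr - (σ b)⁻¹ * w₀) = -(z + rr - (σ b)⁻¹ * w₀) := by
    have hsum : ((σ b)⁻¹ + σ (σ b)⁻¹) * w₀ = z + rr + σ (z + rr) := by rw [hw₀, ← mul_div_assoc, mul_div_cancel_left₀ _ htr0]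
    have e1 : σ (z + rr - (σ b)⁻¹ * w₀) = σ (z + rr) - σ (σ b)⁻¹ * w₀ := by rw [map_sub, map_mul, hσw₀]
    rw [e1]
    linear_combination (-1 : K) * hsum
  -- `|B₂| = |ϖ^N|`
  have hB₂v : Valued.v (b * σ b * (x₁ - x₃)) = Valued.v (ϖ ^ N) := by rw [map_mul, map_mul, hbv, hσbv, one_mul, one_mul, hN]
  -- type B: `N₂ ≥ N` and `N₁ + N₂ = N + M`
  have typeB : N ≤ N₁ → N ≤ N₂ ∧ N₁ + N₂ = N + max N₁ N₂ := by
    intro hNN₁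
    have hN₂N : N ≤ N₂ := by
      have hle : Valued.v (x₃ - x₂) ≤ Valued.v (ϖ ^ N) := by
        rw [show x₃ - x₂ = (x₁ - x₂) - (x₁ - x₃) by ring]
        refine (Valuation.map_sub _ _ _).trans (max_le ?_ (le_of_eq hN))
        rw [hN₁, vle]; exact hNN₁
      rw [hN₂, vle] at hle; exact hle
    refine ⟨hN₂N, ?_⟩
    have hsum : x₁ - x₃ = (x₁ - x₂) - (x₃ - x₂) := by ring
    rcases lt_trichotomy N₁ N₂ with hlt | heq | hgt
    · have : Valued.v (x₁ - x₃) = Valued.v (x₁ - x₂) := by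
        rw [hsum]; exact Valuation.map_sub_eq_of_lt_left _ (by rw [hN₁, hN₂, vlt]; exact hlt)
      rw [hN, hN₁, veq] at this
      rw [max_eq_right hlt.le]; omega
    · subst heq
      have hle : Valued.v (x₁ - x₃) ≤ Valued.v (ϖ ^ N₁) := by
        rw [hsum]; exact (Valuation.map_sub _ _ _).trans (max_le (le_of_eq hN₁) (le_of_eq hN₂))
      rw [hN, vle] at hle
      rw [max_self]; omega
    · have : Valued.v (x₁ - x₃) = Valued.v (x₃ - x₂) := by
        rw [hsum]; exact Valuation.map_sub_eq_of_lt_right _ (by rw [hN₁, hN₂, vlt]; exact hgt)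
      rw [hN, hN₂, veq] at this
      rw [max_eq_left hgt.le]; omega
  -- `|r| ≤ 1` in type B
  have hrv : N ≤ Np → Valued.v rr ≤ 1 := by
    intro hNNp
    rcases h with ⟨_, _, hNp, _⟩ | ⟨hNN₁, _, _⟩
    · exfalso; omega
    · obtain ⟨hN₂N, -⟩ := typeB hNN₁
      have key : rr * ((x₁ - x₃) * x₂) = (x₃ - x₂) * s * (b * x₂ + σ b * x₁) := by
        rw [hrr]; field_simp [sub_ne_zero.2 h13]
      have hv := congrArg Valued.v key
      rw [map_mul, map_mul, hx₂v, mul_one, hN, map_mul, map_mul, hsv, mul_one, hN₂, traceCorner_unit_eq σ hb x₁ x₂] at hv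
      have hu : Valued.v (x₂ + σ b * (x₁ - x₂)) ≤ 1 := v_add_mul_sub_le_one σ hx₂v.le hσbv.le (by rw [hN₁]; exact hd.v_pow_le_one _)
      have hle : Valued.v rr * Valued.v (ϖ ^ N) ≤ 1 * Valued.v (ϖ ^ N) := by
        rw [hv, one_mul]
        calc Valued.v (ϖ ^ N₂) * Valued.v (x₂ + σ b * (x₁ - x₂)) ≤ Valued.v (ϖ ^ N₂) * 1 := mul_le_mul' le_rfl hu
          _ = Valued.v (ϖ ^ N₂) := mul_one _
          _ ≤ Valued.v (ϖ ^ N) := by rw [vle]; exact hN₂N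
      exact le_of_mul_le_mul_right hle (zero_lt_iff.2 hNv)
  -- type A: `|D − x₂| = |ϖ^{N₊}|`
  have hsδ : Np < N → Valued.v ((x₁ * b + x₃ * σ b) - x₂) = Valued.v (ϖ ^ Np) := by
    intro hNpN
    rcases h with ⟨hN₁N, _, hNp, _⟩ | ⟨_, hNNp, _⟩
    · rw [(traceCorner_sub_mid σ hb x₁ x₂ x₃).2, hNp, ← hN₁]
      apply v_sub_add_mul_eq_of_lt
      rw [map_mul, Valuation.map_sub_swap, hN, hσbv, mul_one, hN₁, vlt]
      exact hN₁N
    · exfalso; omega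
  refine ⟨(σ b)⁻¹, (x₃ - x₂) * s / (b * σ b * (x₁ - x₃)), rr, w₀, z + rr - (σ b)⁻¹ * w₀, hκv, htrv, hrv, hB₁, hAD, hG, hr, hc0, hσw₀, hσy₀, hB₂v, hsδ, ?_⟩
  -- the regime datum
  rcases h with ⟨hN₁N, _, hNp, _⟩ | ⟨hNN₁, hNNp, _⟩
  · exact Or.inl (by omega)
  · obtain ⟨hN₂N, hsum⟩ := typeB hNN₁
    have hNM : N ≤ max N₁ N₂ := hNN₁.trans (le_max_left _ _)
    have hC := v_r_mul_s_add_r_pow σ (N := N) (N₁ := N₁) (N₂ := N₂) (M := max N₁ N₂) hb hσbv.le hsv hx₂v hϖ0 (le_of_lt (by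
      rw [hd.vϖ, ← WithZero.exp_zero, WithZero.exp_lt_exp]; norm_num)) hN hN₁ hN₂ hsum hNM
    have hGv := v_G_sub_map_G_eq_pow σ hσσ (N := N) (N₁ := N₁) (N₂ := N₂) (M := max N₁ N₂) hσ1 hσs (map_one _) hbv hσbv hsv hx₁ hx₂ hx₃ hx₂v hϖ0 hN hN₁ hN₂ hsum
    simp only [one_mul] at hGv
    rw [← hrr] at hC
    refine Or.inr ⟨hNNp, hNM, hC.1, fun h1 => hC.2 ?_ ?_, hGv⟩
    · calc Valued.v (x₁ - x₂) = Valued.v (ϖ ^ N₁) := hN₁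
        _ < Valued.v (ϖ ^ 0) := by rw [vlt]; omega
        _ = 1 := by rw [pow_zero, map_one]
    · calc Valued.v (x₃ - x₂) = Valued.v (ϖ ^ N₂) := hN₂
        _ < Valued.v (ϖ ^ 0) := by rw [vlt]; omega
        _ = 1 := by rw [pow_zero, map_one]

set_option maxHeartbeats 800000 in
/-- **THE LETTERS BLOCK, EXPLICIT WITNESSES** (`κ = (σb)⁻¹`, `G`, `r`, `w₀`, `y₀` spelled out — the form a consumer needs when a further binder (the case-(e) count `hce`) mentions `κ, r, s` literally; ★ `exists_traceTorus_jzero_letters` is its `∃`-packaging).  See the module docstring for the dictionary; the witnesses are `κ = (σb)⁻¹`, `G`, `r` of ★ p852069,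
and `w₀, y₀` the 2-free `κ`-frame decomposition of `z + r` (`z` the level element's letter).  [cite: Flicker1998UnitaryFL, Prop. 13 pp. 91–93] [cite: Rogawski1990, §4.9 Prop. 4.9.1 p. 55] -/
theorem traceTorus_jzero_letters_explicit (hd : HermitianLattice.UnramifiedLocalConjDatum σ ϖ)
    {b s x₁ x₂ x₃ z : K} {N N₁ N₂ Np : ℕ}
    (hb : b + σ b = 1) (hbv : Valued.v b = 1) (hσs : σ s = s) (hsv : Valued.v s = 1)
    (hx₁ : σ x₁ * x₁ = 1) (hx₂ : σ x₂ * x₂ = 1) (hx₃ : σ x₃ * x₃ = 1)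
    (hN : Valued.v (x₁ - x₃) = Valued.v (ϖ ^ N)) (hN₁ : Valued.v (x₁ - x₂) = Valued.v (ϖ ^ N₁)) (hN₂ : Valued.v (x₃ - x₂) = Valued.v (ϖ ^ N₂))
    (h : (N₁ < N ∧ N₂ = N₁ ∧ Np = N₁ ∧ Valued.v ((x₁ - x₂) * σ b + (x₃ - x₂) * b) = Valued.v (ϖ ^ N₁)) ∨
      (N ≤ N₁ ∧ N ≤ Np ∧ Valued.v ((x₁ - x₂) * σ b + (x₃ - x₂) * b) ≤ Valued.v (ϖ ^ N))) :
    Valued.v (σ b)⁻¹ = 1 ∧ Valued.v ((σ b)⁻¹ + σ (σ b)⁻¹) = 1 ∧ (N ≤ Np → Valued.v ((x₃ - x₂) * s * (b * x₂ + σ b * x₁) / ((x₁ - x₃) * x₂)) ≤ 1) ∧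
      (x₁ - x₃) = (σ b)⁻¹ * σ (σ b)⁻¹ * (b * σ b * (x₁ - x₃)) ∧
      (x₁ * σ b + x₃ * b) - (x₁ * b + x₃ * σ b) = (σ (σ b)⁻¹ - (σ b)⁻¹) * (b * σ b * (x₁ - x₃)) ∧
      b * σ b * (x₁ - x₃) * ((x₃ - x₂) * s / (b * σ b * (x₁ - x₃))) = ((x₁ * b + x₃ * σ b) - x₂ - (σ b)⁻¹ * (b * σ b * (x₁ - x₃))) * s ∧
      ((x₃ - x₂) * s * (b * x₂ + σ b * x₁) / ((x₁ - x₃) * x₂)) * ((σ b)⁻¹ + σ (σ b)⁻¹) = b * ((x₃ - x₂) * s / (b * σ b * (x₁ - x₃))) + σ b * σ ((x₃ - x₂) * s / (b * σ b * (x₁ - x₃))) ∧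
      z + ((x₃ - x₂) * s * (b * x₂ + σ b * x₁) / ((x₁ - x₃) * x₂)) = (σ b)⁻¹ * ((z + ((x₃ - x₂) * s * (b * x₂ + σ b * x₁) / ((x₁ - x₃) * x₂)) + σ (z + ((x₃ - x₂) * s * (b * x₂ + σ b * x₁) / ((x₁ - x₃) * x₂)))) / ((σ b)⁻¹ + σ (σ b)⁻¹)) + (z + ((x₃ - x₂) * s * (b * x₂ + σ b * x₁) / ((x₁ - x₃) * x₂)) - (σ b)⁻¹ * ((z + ((x₃ - x₂) * s * (b * x₂ + σ b * x₁) / ((x₁ - x₃) * x₂)) + σ (z + ((x₃ - x₂) * s * (b * x₂ + σ b * x₁) / ((x₁ - x₃) * x₂)))) / ((σ b)⁻¹ + σ (σ b)⁻¹))) ∧ σ ((z + ((x₃ - x₂) * s * (b * x₂ + σ b * x₁) / ((x₁ - x₃) * x₂)) + σ (z + ((x₃ - x₂) * s * (b * x₂ + σ b * x₁) / ((x₁ - x₃) * x₂)))) / ((σ b)⁻¹ + σ (σ b)⁻¹)) = ((z + ((x₃ - x₂) * s * (b * x₂ + σ b * x₁) / ((x₁ - x₃) * x₂)) + σ (z +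 ((x₃ - x₂) * s * (b * x₂ + σ b * x₁) / ((x₁ - x₃) * x₂)))) / ((σ b)⁻¹ + σ (σ b)⁻¹)) ∧ σ (z + ((x₃ - x₂) * s * (b * x₂ + σ b * x₁) / ((x₁ - x₃) * x₂)) - (σ b)⁻¹ * ((z + ((x₃ - x₂) * s * (b * x₂ + σ b * x₁) / ((x₁ - x₃) * x₂)) + σ (z + ((x₃ - x₂) * s * (b * x₂ + σ b * x₁) / ((x₁ - x₃) * x₂)))) / ((σ b)⁻¹ + σ (σ b)⁻¹))) = -(z + ((x₃ - x₂) * s * (b * x₂ + σ b * x₁) / ((x₁ - x₃) * x₂)) - (σ b)⁻¹ * ((z + ((x₃ - x₂) * s * (b * x₂ + σ b * x₁) / ((x₁ - x₃) * x₂)) + σ (z + ((x₃ - x₂) * s * (b * x₂ + σ b * x₁) / ((x₁ - x₃) * x₂)))) / ((σ b)⁻¹ + σ (σ b)⁻¹))) ∧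
      Valued.v (b * σ b * (x₁ - x₃)) = Valued.v (ϖ ^ N) ∧
      (Np < N → Valued.v ((x₁ * b + x₃ * σ b) - x₂) = Valued.v (ϖ ^ Np)) ∧
      (Np < N ∨ (N ≤ Np ∧ N ≤ max N₁ N₂ ∧ Valued.v (((x₃ - x₂) * s * (b * x₂ + σ b * x₁) / ((x₁ - x₃) * x₂)) * (s + ((x₃ - x₂) * s * (b * x₂ + σ b * x₁) / ((x₁ - x₃) * x₂)))) ≤ Valued.v (ϖ ^ (max N₁ N₂ - N)) ∧
        (1 ≤ N → Valued.v (((x₃ - x₂) * s * (b * x₂ + σ b * x₁) / ((x₁ - x₃) * x₂)) * (s + ((x₃ - x₂) * s * (b * x₂ + σ b * x₁) / ((x₁ - x₃) * x₂)))) = Valued.v (ϖ ^ (max N₁ N₂ - N))) ∧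
        Valued.v (((x₃ - x₂) * s / (b * σ b * (x₁ - x₃))) - σ ((x₃ - x₂) * s / (b * σ b * (x₁ - x₃)))) = Valued.v (ϖ ^ (max N₁ N₂)))) := by
  have hσσ := hd.σσ
  have hϖ0 : ϖ ≠ 0 := hd.ϖ_ne_zero
  have hσbv : Valued.v (σ b) = 1 := by rw [hd.vσ]; exact hbv
  have hb0 : b ≠ 0 := fun h0 => by rw [h0, map_zero] at hbv; exact zero_ne_one hbv
  have hσb0 : σ b ≠ 0 := fun h0 => by rw [h0, map_zero] at hσbv; exact zero_ne_one hσbv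
  have hx₂v : Valued.v x₂ = 1 := Literature.NumberTheory.LocalFields.valued_eq_one_of_map_mul_self_eq_one hd.vσ hx₂
  have hx20 : x₂ ≠ 0 := fun h0 => by rw [h0, map_zero] at hx₂v; exact zero_ne_one hx₂v
  have h13 : x₁ ≠ x₃ := by
    intro h0; rw [h0, sub_self, map_zero] at hN; exact pow_ne_zero N hϖ0 ((Valuation.zero_iff _).1 hN.symm)
  have hNv : Valued.v (ϖ ^ N) ≠ 0 := (Valuation.ne_zero_iff _).2 (pow_ne_zero N hϖ0)
  have vle : ∀ {i j : ℕ}, Valued.v (ϖ ^ i) ≤ Valued.v (ϖ ^ j) ↔ j ≤ i := fun {i j} => by rw [hd.v_pow, hd.v_pow, WithZero.exp_le_exp]; omega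
  have vlt : ∀ {i j : ℕ}, Valued.v (ϖ ^ i) < Valued.v (ϖ ^ j) ↔ j < i := fun {i j} => by rw [hd.v_pow, hd.v_pow, WithZero.exp_lt_exp]; omega
  have veq : ∀ {i j : ℕ}, Valued.v (ϖ ^ i) = Valued.v (ϖ ^ j) ↔ i = j := fun {i j} => by rw [hd.v_pow, hd.v_pow, WithZero.exp_inj]; omega
  -- the letters at `π = π′ = 1`
  have h11 : (1 : K) * 1 = 1 := one_mul 1
  have hσ1 : σ 1 = 1 := map_one σ
  have hκmul := traceKappa_mul_map σ hσσ (b := b) hσ1 hb0 hσb0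
  have hκadd := traceKappa_add_map σ hσσ hb hσ1 hb0 hσb0
  have hB₁ := traceCorner_B₁_eq σ hσσ h11 hσ1 hb0 hσb0 x₁ x₃
  have hAD := traceCorner_A_sub_D σ hσσ h11 hσ1 hb0 hσb0 x₁ x₃
  have hG := traceCorner_G_spec σ (x₂ := x₂) hb h11 hb0 hσb0 h13 s
  have hr := traceCorner_r_spec σ hσσ hb hσ1 hσs hb0 hσb0 hx₁ hx₂ hx₃ h13
  simp only [one_mul, one_div, one_pow] at hκmul hκadd hB₁ hAD hG hr
  -- valuations of `κ` and `κ + σκ`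
  have hκv : Valued.v (σ b)⁻¹ = 1 := by rw [map_inv₀, hσbv, inv_one]
  have htrv : Valued.v ((σ b)⁻¹ + σ (σ b)⁻¹) = 1 := by
    rw [hκadd, map_inv₀, map_mul, hbv, hσbv, one_mul, inv_one]
  have htr0 : (σ b)⁻¹ + σ (σ b)⁻¹ ≠ 0 := fun h0 => by rw [h0, map_zero] at htrv; exact zero_ne_one htrv
  -- the `κ`-frame decomposition of `z + r`
  obtain ⟨rr, hrr⟩ : ∃ rr : K, rr = (x₃ - x₂) * s * (b * x₂ + σ b * x₁) / ((x₁ - x₃) * x₂) := ⟨_, rfl⟩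
  rw [← hrr] at hr
  obtain ⟨w₀, hw₀⟩ : ∃ w₀ : K, w₀ = (z + rr + σ (z + rr)) / ((σ b)⁻¹ + σ (σ b)⁻¹) := ⟨_, rfl⟩
  have hσκκ : σ ((σ b)⁻¹ + σ (σ b)⁻¹) = (σ b)⁻¹ + σ (σ b)⁻¹ := by rw [map_add, map_inv₀, map_inv₀, hσσ, add_comm]
  have hσw₀ : σ w₀ = w₀ := by
    rw [hw₀, map_div₀, hσκκ, map_add, hσσ, add_comm (σ (z + rr))]
  have hc0 : z + rr = (σ b)⁻¹ * w₀ + (z + rr - (σ b)⁻¹ * w₀) := by ring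
  have hσy₀ : σ (z + rr - (σ b)⁻¹ * w₀) = -(z + rr - (σ b)⁻¹ * w₀) := by
    have hsum : ((σ b)⁻¹ + σ (σ b)⁻¹) * w₀ = z + rr + σ (z + rr) := by rw [hw₀, ← mul_div_assoc, mul_div_cancel_left₀ _ htr0]
    have e1 : σ (z + rr - (σ b)⁻¹ * w₀) = σ (z + rr) - σ (σ b)⁻¹ * w₀ := by rw [map_sub, map_mul, hσw₀]
    rw [e1]
    linear_combination (-1 : K) * hsum
  -- `|B₂| = |ϖ^N|`
  have hB₂v : Valued.v (b * σ b * (x₁ - x₃)) = Valued.v (ϖ ^ N) := by rw [map_mul, map_mul, hbv, hσbv, one_mul, one_mul, hN]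
  -- type B: `N₂ ≥ N` and `N₁ + N₂ = N + M`
  have typeB : N ≤ N₁ → N ≤ N₂ ∧ N₁ + N₂ = N + max N₁ N₂ := by
    intro hNN₁
    have hN₂N : N ≤ N₂ := by
      have hle : Valued.v (x₃ - x₂) ≤ Valued.v (ϖ ^ N) := by
        rw [show x₃ - x₂ = (x₁ - x₂) - (x₁ - x₃) by ring]
        refine (Valuation.map_sub _ _ _).trans (max_le ?_ (le_of_eq hN))
        rw [hN₁, vle]; exact hNN₁
      rw [hN₂, vle] at hle; exact hle
    refine ⟨hN₂N, ?_⟩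
    have hsum : x₁ - x₃ = (x₁ - x₂) - (x₃ - x₂) := by ring
    rcases lt_trichotomy N₁ N₂ with hlt | heq | hgt
    · have : Valued.v (x₁ - x₃) = Valued.v (x₁ - x₂) := by
        rw [hsum]; exact Valuation.map_sub_eq_of_lt_left _ (by rw [hN₁, hN₂, vlt]; exact hlt)
      rw [hN, hN₁, veq] at this
      rw [max_eq_right hlt.le]; omega
    · subst heq
      have hle : Valued.v (x₁ - x₃) ≤ Valued.v (ϖ ^ N₁) := by
        rw [hsum]; exact (Valuation.map_sub _ _ _).trans (max_le (le_of_eq hN₁) (le_of_eq hN₂))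
      rw [hN, vle] at hle
      rw [max_self]; omega
    · have : Valued.v (x₁ - x₃) = Valued.v (x₃ - x₂) := by
        rw [hsum]; exact Valuation.map_sub_eq_of_lt_right _ (by rw [hN₁, hN₂, vlt]; exact hgt)
      rw [hN, hN₂, veq] at this
      rw [max_eq_left hgt.le]; omega
  -- `|r| ≤ 1` in type B
  have hrv : N ≤ Np → Valued.v rr ≤ 1 := by
    intro hNNp
    rcases h with ⟨_, _, hNp, _⟩ | ⟨hNN₁, _, _⟩
    · exfalso; omega
    · obtain ⟨hN₂N, -⟩ := typeB hNN₁
      have key : rr * ((x₁ - x₃) * x₂) = (x₃ - x₂) * s * (b * x₂ + σ b * x₁) := by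
        rw [hrr]; field_simp [sub_ne_zero.2 h13]
      have hv := congrArg Valued.v key
      rw [map_mul, map_mul, hx₂v, mul_one, hN, map_mul, map_mul, hsv, mul_one, hN₂, traceCorner_unit_eq σ hb x₁ x₂] at hv
      have hu : Valued.v (x₂ + σ b * (x₁ - x₂)) ≤ 1 := v_add_mul_sub_le_one σ hx₂v.le hσbv.le (by rw [hN₁]; exact hd.v_pow_le_one _)
      have hle : Valued.v rr * Valued.v (ϖ ^ N) ≤ 1 * Valued.v (ϖ ^ N) := by
        rw [hv, one_mul]
        calc Valued.v (ϖ ^ N₂) * Valued.v (x₂ + σ b * (x₁ - x₂)) ≤ Valued.v (ϖ ^ N₂) * 1 := mul_le_mul' le_rfl hu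
          _ = Valued.v (ϖ ^ N₂) := mul_one _
          _ ≤ Valued.v (ϖ ^ N) := by rw [vle]; exact hN₂N
      exact le_of_mul_le_mul_right hle (zero_lt_iff.2 hNv)
  -- type A: `|D − x₂| = |ϖ^{N₊}|`
  have hsδ : Np < N → Valued.v ((x₁ * b + x₃ * σ b) - x₂) = Valued.v (ϖ ^ Np) := by
    intro hNpN
    rcases h with ⟨hN₁N, _, hNp, _⟩ | ⟨_, hNNp, _⟩
    · rw [(traceCorner_sub_mid σ hb x₁ x₂ x₃).2, hNp, ← hN₁]
      apply v_sub_add_mul_eq_of_lt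
      rw [map_mul, Valuation.map_sub_swap, hN, hσbv, mul_one, hN₁, vlt]
      exact hN₁N
    · exfalso; omega
  subst hw₀
  subst hrr
  refine ⟨hκv, htrv, hrv, hB₁, hAD, hG, hr, hc0, hσw₀, hσy₀, hB₂v, hsδ, ?_⟩
  -- the regime datum
  rcases h with ⟨hN₁N, _, hNp, _⟩ | ⟨hNN₁, hNNp, _⟩
  · exact Or.inl (by omega)
  · obtain ⟨hN₂N, hsum⟩ := typeB hNN₁
    have hNM : N ≤ max N₁ N₂ := hNN₁.trans (le_max_left _ _)
    have hC := v_r_mul_s_add_r_pow σ (N := N) (N₁ := N₁) (N₂ := N₂) (M := max N₁ N₂) hb hσbv.le hsv hx₂v hϖ0 (le_of_lt (by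
      rw [hd.vϖ, ← WithZero.exp_zero, WithZero.exp_lt_exp]; norm_num)) hN hN₁ hN₂ hsum hNM
    have hGv := v_G_sub_map_G_eq_pow σ hσσ (N := N) (N₁ := N₁) (N₂ := N₂) (M := max N₁ N₂) hσ1 hσs (map_one _) hbv hσbv hsv hx₁ hx₂ hx₃ hx₂v hϖ0 hN hN₁ hN₂ hsum
    simp only [one_mul] at hGv
    refine Or.inr ⟨hNNp, hNM, hC.1, fun h1 => hC.2 ?_ ?_, hGv⟩
    · calc Valued.v (x₁ - x₂) = Valued.v (ϖ ^ N₁) := hN₁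
        _ < Valued.v (ϖ ^ 0) := by rw [vlt]; omega
        _ = 1 := by rw [pow_zero, map_one]
    · calc Valued.v (x₃ - x₂) = Valued.v (ϖ ^ N₂) := hN₂
        _ < Valued.v (ϖ ^ 0) := by rw [vlt]; omega
        _ = 1 := by rw [pow_zero, map_one]


end Literature.NumberTheory.Automorphic.UnitaryGroup
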